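import Literature.AnabelianGeometry.EtaleTheta.Discharge.Sec1Thm16iiiOfRootClauses
import HarnessLib

/-!
# [EtTh] Thm. 1.6 (iii): the valuation row (K3 L11 (b)(c), binder `hV`) FROM Thm. 1.6 (ii) — «in light of the
# compatibility shown in assertion (ii)» (proof-only)

Mochizuki, *The étale theta function and its Frobenioid-theoretic manifestations*, Publ. RIMS **45** (2009), Thm. 1.6
(ii)(iii) pp. 24–25; proof of (iii), p. 25 l. 31–33: «This “reduction of indeterminacy from (K̈^×)^∧ to O^×_K̈” may be
achieved [in light of the compatibility shown in assertion (ii)] by evaluating the classes η̈^Θ at a cusp …»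
[cite: MochizukiEtTh2009, Thm 1.6 (iii) p.25]. abc-iut cell, layer L2, seat abc-iut-L2-t1 (§1 ROOT owner; the frozen
`ThetaSetting.Thm16ii`, FACT-LIST F-0586, is this lineage's typing). PROOF-ONLY (0 `def`).

abc-iut-L6-d5's K3 capstone (`Thm16Sub.thm16iii_of_printedClauses`) and this seat's `thm16iii_of_rootClauses` (p444577)
take row L11 (b)(c) as the binder `hV : ∀ δ, (transport ∘ κ_α = κ_β ∘ δ) → DeltaPreservesUnitsAndOne δ Vα Vβ` (the [AbsAnab]
Prop. 1.2.1 (iv)(vi)(vii) clauses for the induced `δ`). Print derives them from assertion (ii) itself. HERE: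
* `ThetaSetting.ThetaCompanion.eq_of_comm` — theta companions are UNIQUE (the square `(·)^Θ ∘ γ = γ^Θ ∘ (·)^Θ` and
  the surjectivity of `(·)^Θ` pin `γ^Θ`; no `hΔ` needed) — so `Thm16ii`'s existential companion IS the capstone's `c`;
* `ThetaSetting.delta_unique_of_transport` — the `δ` induced on Kummer classes is unique (`kumYdd`, `infl` injective);
* `ThetaSetting.hV_of_thm16ii` — **`Thm16ii γ h Eα Eβ Vα Vβ ⇒ hV`**;
* `Thm16Sub.thm16iii_of_thm16ii_rootClauses` — Thm. 1.6 (iii) from `thm16iii_of_rootClauses` with `hV` replaced by the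
  typed FACT `Thm16ii` (F-0586) — print's own dependency (iii) ⟸ (ii).
HONEST FRAMING: [EtTh] is refereed; nothing here bears on [IUTchIII] Cor. 3.12; typed ≠ proved; no side taken.
-/

noncomputable section

namespace Literature.AnabelianGeometry.EtaleTheta

open Literature.AnabelianGeometry.SemiGraphs

namespace ThetaSetting

variable {p : ℕ} [Fact p.Prime] {Dα Dβ : ThetaSetting p} {γ : Dα.PiTemp ≃ₜ* Dβ.PiTemp}

/-- **Theta companions are unique**: two companions of the same `γ` coincide (their isomorphisms of theta quotients
agree on the image of the surjection `(·)^Θ`). [cite: MochizukiEtTh2009, Thm 1.6 (ii) p.24] -/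
theorem ThetaCompanion.eq_of_comm (c c' : ThetaCompanion γ) : c = c' := by
  have h : c.thetaIso = c'.thetaIso := by
    apply ContinuousMulEquiv.ext
    intro y
    obtain ⟨x, rfl⟩ := Dα.toTheta_surjective y
    have h1 := c.comm x
    have h2 := c'.comm x
    change Dβ.toTheta (γ x) = c.thetaIso (Dα.toTheta x) at h1
    change Dβ.toTheta (γ x) = c'.thetaIso (Dα.toTheta x) at h2
    rw [← h1, ← h2]
  cases c
  cases c'
  cases h
  rfl

/-- **The `δ` induced by `γ` on Kummer classes of constants is unique** («the isomorphism induced by γ», Thm. 1.6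
(ii)): `kumYdd` and inflation are injective. [cite: MochizukiEtTh2009, Thm 1.6 (ii) p.24] -/
theorem delta_unique_of_transport (h : Thm16i γ) (c : ThetaCompanion γ) {Eα : Dα.KummerData} {Eβ : Dβ.KummerData}
    (δ δ' : Eα.KddHat ≃* Eβ.KddHat)
    (hδ : ∀ a, transport c h (Dα.inflTheta Dα.GtpYdd (Eα.kumYdd a)) = Dβ.inflTheta Dβ.GtpYdd (Eβ.kumYdd (δ a)))
    (hδ' : ∀ a, transport c h (Dα.inflTheta Dα.GtpYdd (Eα.kumYdd a)) = Dβ.inflTheta Dβ.GtpYdd (Eβ.kumYdd (δ' a))) :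
    δ = δ' := by
  apply MulEquiv.ext
  intro a
  apply Eβ.kumYdd_injective
  apply Dβ.inflTheta_injective Dβ.GtpYdd
  rw [← hδ a, hδ' a]

/-- **Row L11 (b)(c) of the K3 capstone FROM Thm. 1.6 (ii)**: the typed FACT `Thm16ii γ h Eα Eβ Vα Vβ` (F-0586) yields
the binder `hV` — for every `δ` induced by the transport (necessarily THE `δ` of (ii), companions and induced `δ` being
unique), `δ` preserves `Ker((K̈^×)^∧ ↠ Ẑ)` and «the elements 1 ∈ Ẑ». [cite: MochizukiEtTh2009, Thm 1.6 (ii) p.24] -/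
theorem hV_of_thm16ii (h : Thm16i γ) (c : ThetaCompanion γ) {Eα : Dα.KummerData} {Eβ : Dβ.KummerData}
    {Vα : ValuationHatData Dα Eα} {Vβ : ValuationHatData Dβ Eβ} (h16 : Thm16ii γ h Eα Eβ Vα Vβ)
    (δ : Eα.KddHat ≃* Eβ.KddHat)
    (hδ : ∀ a, transport c h (Dα.inflTheta Dα.GtpYdd (Eα.kumYdd a)) = Dβ.inflTheta Dβ.GtpYdd (Eβ.kumYdd (δ a))) :
    Thm16Sub.DeltaPreservesUnitsAndOne δ Vα Vβ := by
  obtain ⟨c', δ', hδ', hU, hϖ⟩ := h16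
  have hcc : c' = c := ThetaCompanion.eq_of_comm c' c
  subst hcc
  have hδδ : δ = δ' := delta_unique_of_transport h c' δ δ' hδ hδ'
  subst hδδ
  exact ⟨hU, hϖ⟩

end ThetaSetting

namespace Thm16Sub

open Literature.AnabelianGeometry.SemiGraphs

variable {p : ℕ} [Fact p.Prime] {Dα Dβ : ThetaSetting p} {γ : Dα.PiTemp ≃ₜ* Dβ.PiTemp}

/-- **[EtTh] Theorem 1.6 (iii) from the ROOT clauses and Theorem 1.6 (ii)**: as `thm16iii_of_rootClauses`, with the
valuation binder `hV` ([AbsAnab] 1.2.1 clauses for the induced `δ`) REPLACED by the typed FACT `Thm16ii` (F-0586) — print,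
p. 25: «[in light of the compatibility shown in assertion (ii)]». [cite: MochizukiEtTh2009, Thm 1.6 (iii) p.25] -/
theorem thm16iii_of_thm16ii_rootClauses (h : ThetaSetting.Thm16i γ) (c : ThetaSetting.ThetaCompanion γ)
    (hΔ : Dα.DeltaTemp.map γ.toMulEquiv.toMonoidHom = Dβ.DeltaTemp)
    (Eα : Dα.EtaleThetaData) (Eβ : Dβ.EtaleThetaData) (hCα : Dα.Compat) (hCβ : Dβ.Compat)
    (hSβ : Dβ.Sec2Hyps) (h15iiα : ThetaSetting.Prop15ii Eα.toKummerData hCα)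
    (h15ii : ThetaSetting.Prop15ii Eβ.toKummerData hCβ)
    (h15α : ThetaSetting.Prop15iii Eα hCα) (h15β : ThetaSetting.Prop15iii Eβ hCβ)
    {σ : Dβ.PiTemp} (hσ : σ ∈ Dβ.GtpYdd)
    -- Thm 1.6 (ii) as the typed FACT for some valuation data with the genuine kernels
    (Vα : ThetaSetting.ValuationHatData Dα Eα.toKummerData)
    (Vβ : ThetaSetting.ValuationHatData Dβ Eβ.toKummerData)
    (hVα : Vα.unitsHat = Dα.unitsOKdd.map Eα.toKddHat) (hVβ : Vβ.unitsHat = Dβ.unitsOKdd.map Eβ.toKddHat)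
    (h16ii : ThetaSetting.Thm16ii γ h Eα.toKummerData Eβ.toKummerData Vα Vβ)
    -- the β-side ROOT inputs: topology (census S1-1), the guard, Prop 1.5 (ii) clause (a)
    (hTβ : Dβ.HasThetaTopology) (hOβ : Dβ.IsEtThOrigin)
    {lamβ : ↥((Dβ.DtpYddN 1).map Dβ.toTheta) →ₜ* Dβ.DeltaTheta} (hstdβ : ThetaSetting.IsStdLog lamβ)
    (hresβ : ContH1.res (MonoidHom.id Dβ.GtpTheta) Dβ.DeltaTheta Dβ.map_toTheta_DtpYddN_one_le Eβ.logUdd =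
      ThetaSetting.homClass ThetaSetting.dtpYddTheta_le_deltaTheta_map lamβ)
    -- Prop 1.5 (iii) ι-clauses for COMPATIBLE inversion automorphisms (root predicates)
    {ια : Dα.PiTemp ≃ₜ* Dα.PiTemp} (hια : Dα.IsInversionAut ια) (cα : ThetaSetting.ThetaCompanion ια)
    (hInvα : ThetaSetting.InvClauses Eα hια cα)
    {ιβ : Dβ.PiTemp ≃ₜ* Dβ.PiTemp} (hιβ : Dβ.IsInversionAut ιβ) (cβ : ThetaSetting.ThetaCompanion ιβ)
    (hInvβ : ThetaSetting.InvClauses Eβ hιβ cβ)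
    (hcompat : ∀ g, γ.toMulEquiv (ια.toMulEquiv g) = ιβ.toMulEquiv (γ.toMulEquiv g))
    -- row L15: the two cusp evaluations
    (y : ThetaSetting.CuspidalPointDd Eβ.toKummerData) {u₁ u₂ v₁ v₂ : (↥Dβ.Kdd)ˣ}
    (hu₁ : u₁ ∈ Dβ.unitsOKdd) (hu₂ : u₂ ∈ Dβ.unitsOKdd)
    (hv : ‖((v₁ : Dβ.Kdd) : PadicAlgCl p)‖ = ‖((v₂ : Dβ.Kdd) : PadicAlgCl p)‖)
    (h₁ : haveI := hCβ.GtpYdd_normal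
      y.evalAt (ContH1.res Dβ.toTheta Dβ.DeltaTheta (y.sec_le.trans y.Dpt_le)
        (ContH1.conj Dβ.toTheta Dβ.DeltaTheta σ Eβ.etaDd)) = Eβ.toKddHat (u₁ * v₁))
    (h₂ : y.evalAt (ContH1.res Dβ.toTheta Dβ.DeltaTheta (y.sec_le.trans y.Dpt_le)
        (ThetaSetting.transport c h Eα.etaDd)) = Eβ.toKddHat (u₂ * v₂)) :
    ThetaSetting.Thm16iii γ h c Eα Eβ hCβ :=
  thm16iii_of_rootClauses h c hΔ Eα Eβ hCα hCβ hSβ h15iiα h15ii h15α h15β hσ Vα Vβ hVα hVβ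
    (fun δ hδ => ThetaSetting.hV_of_thm16ii h c h16ii δ hδ) hTβ hOβ hstdβ hresβ hια cα hInvα hιβ cβ hInvβ hcompat
    y hu₁ hu₂ hv h₁ h₂

end Thm16Sub

end Literature.AnabelianGeometry.EtaleTheta

end
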